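import Mathlib
import HarnessLib
import Summits.HubbardSuperconductivity.HubbardSuperconductivity.Theorems.KLProgrammePlanarSoftPartnerSplit

/-!
# Route `KLProgramme` — crux K3, ENGINE child gen 6 (stmt-HubbardSuperconductivity-20236 `KLRegimeEngineV16`), stub `stub_engine_step_values`,
# (E2-v10) ph-loop inputs ON THE MODEL CARRIER: the forward loop with a LOCALISED vertex `A + R_i` (flat part by zero sound, remainder sign-blind)
# (cell gate-hubbard-kl, seat hubbard-kl-k3c2-p2 g7)

`klhp_planar_soft_split_norm_le` (p523188) composed with the generic lattice step `klhl_lattice_soft_of_planar_bound` (p520984), exactly as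
`…LatticeForwardBubble` §4: the flat weight `A` and the remainders `R_i` are doubly `2π`-periodic continuous Lipschitz functions on the plane (the
taker's periodisations, `klfl_periodize`), the square cutoff `ψ = klfl_squareCut zm` localises them to the open square for the planar step (radial
Lipschitz constant of `A·ψ`: `L_A + A₀·2/zm`), and the torus average differs from the planar integral by `32Λ_n·K/L`.
Result: **`klhl_lattice_soft_split_norm_le`**.

Pure analysis; nothing about the model's effective action is asserted; nothing asserts superconductivity.
-/

noncomputable section

namespace Summit.HubbardSuperconductivity.HubbardSuperconductivity.Theorems.KLRegimeSplit

set_option linter.dupNamespace false -- summit = problem name (single-conjunct summit), D-0017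

open Real Set Filter MeasureTheory Complex Literature.MathematicalPhysics.QuantumLattice Literature.Probability.LatticeModels
open Literature.MathematicalPhysics.QuantumLattice.BandSectorCounting
open Summit.HubbardSuperconductivity.HubbardSuperconductivity.Theorems.PerturbedFermiCurve
open Summit.HubbardSuperconductivity.HubbardSuperconductivity.Theorems.KLProgrammeLegKernels
open scoped NNReal

section Lattice

variable {a' b' : ℝ} (B : BandBounds a' b') {δ : (Fin 2 → ℝ) → ℝ} (hδ1 : ContDiff ℝ 1 δ) {κ₀ κ₁ : ℝ}
  (hδ : ∀ k : Fin 2 → ℝ, (∀ i, |k i| ≤ π) → |δ k| ≤ κ₀)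
  (hκ : ∀ k : Fin 2 → ℝ, (∀ i, |k i| ≤ π) → ‖fderiv ℝ δ k‖ ≤ κ₁) (hκ₁ : κ₁ < B.Dtmin)

/-- Radial Lipschitz constant of a cut-off weight `A·ψ`: `(L_A + A₀·2/zm)` (sup metric Lipschitz `A`, `‖A‖ ≤ A₀`, `ψ = klfl_squareCut zm`). -/
theorem klhl_cutWeight_radial_lipschitz {A : ℝ × ℝ → ℂ} {A₀ La zm : ℝ} (hzm : 0 < zm) (hA0' : 0 ≤ A₀) (hLa0 : 0 ≤ La)
    (hA0 : ∀ p, ‖A p‖ ≤ A₀) (hLa : ∀ p q, ‖A p - A q‖ ≤ La * dist p q) (θ t t' : ℝ) :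
    ‖A (t * Real.cos θ, t * Real.sin θ) * (klfl_squareCut zm (t * Real.cos θ, t * Real.sin θ) : ℂ) -
        A (t' * Real.cos θ, t' * Real.sin θ) * (klfl_squareCut zm (t' * Real.cos θ, t' * Real.sin θ) : ℂ)‖ ≤
      (La + A₀ * (2 / zm)) * |t - t'| := by
  set x := (t * Real.cos θ, t * Real.sin θ) with hx
  set y := (t' * Real.cos θ, t' * Real.sin θ) with hy
  have hψbd : ∀ p, ‖(klfl_squareCut zm p : ℂ)‖ ≤ 1 := fun p => by
    rw [Complex.norm_real, Real.norm_of_nonneg (klfl_squareCut_mem zm p).1]; exact (klfl_squareCut_mem zm p).2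
  have hd : dist x y ≤ |t - t'| := klfl_dist_ray_le θ t t'
  have hsplit : A x * (klfl_squareCut zm x : ℂ) - A y * (klfl_squareCut zm y : ℂ) =
      (A x - A y) * (klfl_squareCut zm x : ℂ) + A y * ((klfl_squareCut zm x : ℂ) - (klfl_squareCut zm y : ℂ)) := by ring
  rw [hsplit]
  have h1 : ‖(A x - A y) * (klfl_squareCut zm x : ℂ)‖ ≤ La * |t - t'| * 1 := by
    rw [norm_mul]
    exact mul_le_mul ((hLa x y).trans (mul_le_mul_of_nonneg_left hd hLa0)) (hψbd x) (norm_nonneg _) (by positivity)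
  have h2 : ‖A y * ((klfl_squareCut zm x : ℂ) - (klfl_squareCut zm y : ℂ))‖ ≤ A₀ * (2 / zm * |t - t'|) := by
    rw [norm_mul, ← Complex.ofReal_sub, Complex.norm_real, Real.norm_eq_abs]
    exact mul_le_mul (hA0 y) ((klfl_squareCut_lipschitz hzm x y).trans (mul_le_mul_of_nonneg_left hd (by positivity))) (abs_nonneg _) hA0'
  calc _ ≤ ‖(A x - A y) * (klfl_squareCut zm x : ℂ)‖ + ‖A y * ((klfl_squareCut zm x : ℂ) - (klfl_squareCut zm y : ℂ))‖ := norm_add_le _ _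
    _ ≤ La * |t - t'| * 1 + A₀ * (2 / zm * |t - t'|) := add_le_add h1 h2
    _ = (La + A₀ * (2 / zm)) * |t - t'| := by ring

include B hδ1 hδ hκ hκ₁ in
/-- **THE FORWARD LOOP WITH A LOCALISED VERTEX ON `MatsubaraIdx M × TorusSite 2 L`.**  Flat periodic weight `A` (`‖A‖ ≤ A₀`, `L_A`-Lipschitz),
periodic remainders `R_i` (`‖R_i‖ ≤ ε`, `L_R`-Lipschitz), the frame/bands/margins/zone margin of `klhl_lattice_soft_signblind_norm_le`, the weights
`f, d, f·d` and the below-resolution transfer of `klhp_planar_soft_split_norm_le` (`|2πm₀/β| ≤ Λ_n/8`, `|ẽ′ − e| ≤ δ_max ≤ Λ_n/8` on the open square,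
ray shifts `½`-Lipschitz), `M ≥ β·4Λ_n/(2π) + 1`.  Then the lattice bubble with weights `A + R_i` is
`≤ (2π)⁻²·(ZS(A·ψ) + 2π·(512/π)·M_f·(ε·π√2/d)·M′) + 32Λ_n·K/L`, `K` as in `klhl_lattice_soft_signblind_norm_le` with `(A₀, L_a) ↦ (A₀ + ε, L_A + L_R)`. -/
theorem klhl_lattice_soft_split_norm_le
    {M : ℕ} {A : ℝ × ℝ → ℂ} (hAc : Continuous A) (hA1p : ∀ x y, A (x + 2 * π, y) = A (x, y)) (hA2p : ∀ x y, A (x, y + 2 * π) = A (x, y))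
    {A₀ LA : ℝ} (hA00 : 0 ≤ A₀) (hA0 : ∀ p, ‖A p‖ ≤ A₀) (hLA0 : 0 ≤ LA) (hLA : ∀ p q, ‖A p - A q‖ ≤ LA * dist p q)
    {R : MatsubaraIdx M → ℝ × ℝ → ℂ} (hRc : ∀ i, Continuous (R i)) (hR1p : ∀ i x y, R i (x + 2 * π, y) = R i (x, y))
    (hR2p : ∀ i x y, R i (x, y + 2 * π) = R i (x, y))
    {ε LR : ℝ} (hε : 0 ≤ ε) (hRε : ∀ i p, ‖R i p‖ ≤ ε) (hLR0 : 0 ≤ LR) (hLR : ∀ i p q, ‖R i p - R i q‖ ≤ LR * dist p q)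
    {κ₂ : ℝ} (hκ₂ : 0 ≤ κ₂)
    (hD2 : ∀ θ s t : ℝ, s ∈ Icc 0 (π / ‖dir θ‖) → t ∈ Icc 0 (π / ‖dir θ‖) →
      |fderiv ℝ δ (s • dir θ) (dir θ) - fderiv ℝ δ (t • dir θ) (dir θ)| ≤ κ₂ * |s - t|)
    {eb : ℝ × ℝ → ℝ} (hebc : Continuous eb) (heb1 : ∀ x y, eb (x + 2 * π, y) = eb (x, y)) (heb2 : ∀ x y, eb (x, y + 2 * π) = eb (x, y))
    {Le : ℝ} (hLe : ∀ p q, |eb p - eb q| ≤ Le * dist p q) {μ : ℝ} (heb : ∀ p ∈ Icc (-π) π ×ˢ Icc (-π) π, eb p = klfb_band δ μ p)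
    {eb' : ℝ × ℝ → ℝ} (heb'c : Continuous eb') (heb'1 : ∀ x y, eb' (x + 2 * π, y) = eb' (x, y)) (heb'2 : ∀ x y, eb' (x, y + 2 * π) = eb' (x, y))
    {Le' : ℝ} (hLe' : ∀ p q, |eb' p - eb' q| ≤ Le' * dist p q) {δmax : ℝ} (hδ0 : 0 ≤ δmax) {n : ℕ} (hδmax : δmax ≤ klScale klE0 n / 8)
    (he'δ : ∀ p : ℝ × ℝ, |p.1| < π → |p.2| < π → |eb' p - klfb_band δ μ p| ≤ δmax)
    {zm : ℝ} (hzm : 0 < zm)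
    (hzone : ∀ p ∈ Icc (-π) π ×ˢ Icc (-π) π, |eb p| < 4 * klScale klE0 n → |p.1| ≤ π - 2 * zm ∧ |p.2| ≤ π - 2 * zm)
    (hσ : ∀ θ : ℝ, ∀ e ∈ Icc (-(4 * klScale klE0 n)) (4 * klScale klE0 n), ∀ e'' ∈ Icc (-(4 * klScale klE0 n)) (4 * klScale klE0 n),
      |klfb_shift δ μ eb' θ e - klfb_shift δ μ eb' θ e''| ≤ |e - e''| / 2)
    {f d : ℝ → ℂ} {Lf Mf ℓf Ld M' ℓ' LF MF ℓ : ℝ}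
    (hlip : ∀ s s', ‖f s - f s'‖ ≤ Lf * |s - s'|) (hbd : ∀ s, ‖f s‖ ≤ Mf) (hLf : Lf ≤ ℓf / klScale klE0 n ^ 2)
    (hin : ∀ s, s ≤ (klScale klE0 n / 2) ^ 2 → f s = 0) (hout : ∀ s, (4 * klScale klE0 n) ^ 2 ≤ s → f s = 0)
    (hdlip : ∀ s s', ‖d s - d s'‖ ≤ Ld * |s - s'|) (hdbd : ∀ s, ‖d s‖ ≤ M') (hLd : Ld ≤ ℓ' / klScale klE0 n ^ 2)
    (hdout : ∀ s, (4 * klScale klE0 n) ^ 2 ≤ s → d s = 0)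
    (hMF : 0 ≤ MF) (hFlip : ∀ s s', ‖f s * d s - f s' * d s'‖ ≤ LF * |s - s'|) (hFbd : ∀ s, ‖f s * d s‖ ≤ MF)
    (hLF : LF ≤ ℓ / klScale klE0 n ^ 2)
    (hlo : a' < μ - 4 * klScale klE0 n - κ₀) (hhi : μ + 4 * klScale klE0 n + κ₀ < b')
    {β : ℝ} (hβ : klBetaMin ≤ β) (hn : n ≤ nScales β + 1) (m₀ : ℤ) (hq₀ : |2 * Real.pi * (m₀ : ℝ) / β| ≤ klScale klE0 n / 8)
    (hM : β * (4 * klScale klE0 n) / (2 * Real.pi) + 1 ≤ M) (L : ℕ) [NeZero L] :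
    ‖β⁻¹ • ∑ i : MatsubaraIdx M, ((L ^ 2 : ℕ) : ℝ)⁻¹ • ∑ k : TorusSite 2 L,
        (A (latticeMomentum L k 0, latticeMomentum L k 1) + R i (latticeMomentum L k 0, latticeMomentum L k 1)) *
          klfb_prop f (matsubaraFreq β M i) (eb (latticeMomentum L k 0, latticeMomentum L k 1)) *
            klfb_prop d (matsubaraFreq β M i + 2 * Real.pi * (m₀ : ℝ) / β) (eb' (latticeMomentum L k 0, latticeMomentum L k 1))‖ ≤
      ((2 * π) ^ 2)⁻¹ *
          (2 * Real.pi *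
              (524288 / Real.pi * (ℓ + 8 * MF) *
                  (Real.pi * Real.sqrt 2 / (B.Dtmin - κ₁) * (LA + A₀ * (2 / zm)) / (B.Dtmin - κ₁) +
                    A₀ * (1 / (B.Dtmin - κ₁) ^ 2 + Real.pi * Real.sqrt 2 * (2 + κ₂) / (B.Dtmin - κ₁) ^ 3)) * klScale klE0 n +
                393216 / Real.pi * (ℓ + 8 * MF) * (A₀ * (Real.pi * Real.sqrt 2 / (B.Dtmin - κ₁))) * ((Real.pi / β) / klScale klE0 n) +
                  256 / Real.pi * Mf * (A₀ * (Real.pi * Real.sqrt 2 / (B.Dtmin - κ₁))) *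
                    ((65 * ℓ' + 17408 / 3 * M') / klScale klE0 n ^ 2 * klScale klE0 n) * (|2 * Real.pi * (m₀ : ℝ) / β| + δmax)) +
            2 * Real.pi * (512 / Real.pi * Mf * (ε * (Real.pi * Real.sqrt 2 / (B.Dtmin - κ₁)) * M'))) +
        32 * klScale klE0 n *
            ((LA + LR) * (2 * Mf / klScale klE0 n) * (M' * β / Real.pi) +
              (A₀ + ε) * ((9 * ℓf + 4 * Mf) / klScale klE0 n ^ 2 * Le) * (M' * β / Real.pi) +
              (A₀ + ε) * (2 * Mf / klScale klE0 n) * ((2 * Ld + M' * β ^ 2 / Real.pi ^ 2) * Le')) / L := by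
  -- the cut-off weights
  have hψbd : ∀ p, ‖(klfl_squareCut zm p : ℂ)‖ ≤ 1 := fun p => by
    rw [Complex.norm_real, Real.norm_of_nonneg (klfl_squareCut_mem zm p).1]; exact (klfl_squareCut_mem zm p).2
  have hψc : Continuous fun p : ℝ × ℝ => (klfl_squareCut zm p : ℂ) := Complex.continuous_ofReal.comp (klfl_continuous_squareCut zm)
  have hsupp : ∀ (g : ℝ × ℝ → ℂ) (p : ℝ × ℝ), g p * (klfl_squareCut zm p : ℂ) ≠ 0 → |p.1| < π ∧ |p.2| < π := by
    intro g p hp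
    have hψ : klfl_squareCut zm p ≠ 0 := fun h0 => hp (by simp only [h0, Complex.ofReal_zero, mul_zero])
    obtain ⟨h1, h2⟩ := klfl_abs_lt_of_squareCut_ne_zero hzm hψ
    exact ⟨by linarith, by linarith⟩
  have hAψbd : ∀ p, ‖A p * (klfl_squareCut zm p : ℂ)‖ ≤ A₀ := fun p => by
    rw [norm_mul]
    calc ‖A p‖ * ‖(klfl_squareCut zm p : ℂ)‖ ≤ A₀ * 1 := mul_le_mul (hA0 p) (hψbd p) (norm_nonneg _) hA00
      _ = A₀ := mul_one _
  have hRψbd : ∀ i p, ‖R i p * (klfl_squareCut zm p : ℂ)‖ ≤ ε := fun i p => by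
    rw [norm_mul]
    calc ‖R i p‖ * ‖(klfl_squareCut zm p : ℂ)‖ ≤ ε * 1 := mul_le_mul (hRε i p) (hψbd p) (norm_nonneg _) hε
      _ = ε := mul_one _
  have hArad := klhl_cutWeight_radial_lipschitz hzm hA00 hLA0 hA0 hLA
  -- the planar split bound on the cut family
  have hP := klhp_planar_soft_split_norm_le B hδ1 hδ hκ hκ₁ (A := fun p => A p * (klfl_squareCut zm p : ℂ)) (hAc.mul hψc) (hsupp A)
    hAψbd (fun θ t t' _ _ => hArad θ t t') (R := fun i p => R i p * (klfl_squareCut zm p : ℂ)) (fun i => (hRc i).mul hψc)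
    (fun i => hsupp (R i)) hε hRψbd hκ₂ hD2 hlip hbd hin hout hdlip hdbd hLd hdout hMF hFlip hFbd hLF heb'c hδ0 hδmax he'δ hσ hlo hhi hβ hn m₀ hq₀ hM
  -- rewrite the cut family as `(A + R_i)·ψ`
  have hfam : ∀ i : MatsubaraIdx M, klfb_integrand δ μ (fun p => A p * (klfl_squareCut zm p : ℂ) + R i p * (klfl_squareCut zm p : ℂ)) f d eb'
      (matsubaraFreq β M i) (2 * Real.pi * (m₀ : ℝ) / β) =
      klfb_integrand δ μ (fun p => (A p + R i p) * (klfl_squareCut zm p : ℂ)) f d eb' (matsubaraFreq β M i) (2 * Real.pi * (m₀ : ℝ) / β) := by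
    intro i; funext p; unfold klfb_integrand; ring
  simp only [hfam] at hP
  -- the lattice step with `a_i = A + R_i`
  have h := klhl_lattice_soft_of_planar_bound (a := fun i p => A p + R i p) (fun i => hAc.add (hRc i))
    (fun i x y => by simp only [hA1p, hR1p]) (fun i x y => by simp only [hA2p, hR2p]) (by positivity : 0 ≤ A₀ + ε)
    (fun i p => (norm_add_le _ _).trans (add_le_add (hA0 p) (hRε i p))) (by positivity : 0 ≤ LA + LR)
    (fun i p q => by
      calc ‖A p + R i p - (A q + R i q)‖ = ‖(A p - A q) + (R i p - R i q)‖ := by ring_nf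
        _ ≤ ‖A p - A q‖ + ‖R i p - R i q‖ := norm_add_le _ _
        _ ≤ LA * dist p q + LR * dist p q := add_le_add (hLA p q) (hLR i p q)
        _ = (LA + LR) * dist p q := by ring)
    hebc heb1 heb2 hLe heb heb'c heb'1 heb'2 hLe' hzm hzone hlip hbd hLf hin hout hdlip hdbd hβ hn m₀ hP L
  exact h

end Lattice

end Summit.HubbardSuperconductivity.HubbardSuperconductivity.Theorems.KLRegimeSplit

end
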